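import Mathlib
import HarnessLib
import Summits.HubbardSuperconductivity.HubbardSuperconductivity.Theorems.ComplexGFFStiffnessHypACumulantPackageNeZero
import Literature.MathematicalPhysics.StatisticalMechanics.WeightTheoremABKMPackage
import Literature.MathematicalPhysics.StatisticalMechanics.RGStepParamsABKM
import Literature.MathematicalPhysics.StatisticalMechanics.RGStepSigmaLimitABKM
import Literature.MathematicalPhysics.StatisticalMechanics.RGStepSigmaABKM
import Literature.MathematicalPhysics.StatisticalMechanics.LinearisedMapContrConstDecay

/-!
# Crux `HypACumulant`, line `gnv` — `GNV` from the finite-range decomposition: the `N`-uniform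
# choice of the parameters of [ABKM19] Ch. 12 (proof of Theorem 12.1 / Theorem 2.2, representation half)

Route `route-HubbardSuperconductivity-ComplexGFFStiffness`, crux item stmt-HubbardSuperconductivity-19154,
research stub `stub_gnvOfFrd : TorusFRD 4 → GNV`.  With `pertZ_ne_zero_of_package` (the whole
renormalisation-group argument at fixed `(L, N)`) in hand, `GNV` is the statement that the package
hypotheses can be met with constants depending on `L` only: `d = 4`, `M_ord = R = 8`, `p_Φ = 4`,
`r₀ = 3`, regularity orders `(16, 17)`, `θ̄ = ⅛`, `λ = ½`, `θ = 1/16`, `η = ½`, `κ = ⅞`; for each odd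
`L ≥ L₀` the weight schedule `(μ, δ₁, δ₀)` of Theorem 7.1 (`abkm_weight_bounds_of_package`), `h`,
`T₀`, the large-set parameter `A` (`eventually_atTop_sideConditions`, `exists_sigmaABKM_zero_lt`), the
ball radius `r` (`eventually_nhds_ballConditions`, continuity of `σ`), the Hamiltonian radius `ρ`, the
tube width `ε = min(r, ρ)`, and finally the radius `ρ_𝒦` of `ι`-admissible perturbations; `L₀` comes
from `L ≥ 256` and `L^4 · abkmContrConst 4 L 8 → 0` (`tendsto_pow_mul_abkmContrConst`).

* **`gnv_of_torusFRD : TorusFRD 4 → GNV`.**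

Honest framing: this is ABKM19's Theorem 2.2 (representation half: `𝒵_N ≠ 0`) transcribed to the
`ι`-symmetric complex class; it says nothing about the Hubbard model beyond the crux's reduction.
All proved; no `sorry`.

## References
* S. Adams, S. Buchholz, R. Kotecký, S. Müller, arXiv:1910.13564, Theorem 2.2, proof of Theorem 12.1
  [AdamsBuchholzKoteckyMuller2019].
-/

noncomputable section

-- `Summit.<Summit>.<Problem>`: single-conjunct summit, the duplicate component is mandated (D-0017).
set_option linter.dupNamespace false

namespace Summit.HubbardSuperconductivity.HubbardSuperconductivity.Theorems.ComplexGFF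

open scoped BigOperators ComplexConjugate Topology
open Real Set Finset MeasureTheory Filter
open Literature.MathematicalPhysics.StatisticalMechanics.GradientRG
open Literature.MathematicalPhysics.StatisticalMechanics.GradientFRD
  (fourierCoeff IsElliptic IsUnitSymm InShell iterDiff supNorm conv ellOp isElliptic_one TorusFRD)
open Literature.MathematicalPhysics.QuantumFieldTheory
open Literature.Dynamics.Hyperbolic

set_option maxHeartbeats 3200000 in
/-- **`GNV` from the finite-range decomposition `TorusFRD 4`** (module docstring): [ABKM19] Theorem 2.2
(representation half) on the `ι`-symmetric complex class, uniformly in `N`. -/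
theorem gnv_of_torusFRD (hfrd : TorusFRD 4) : GNV := by
  -- the finite-range decomposition package at `ω₀ = ½`, `Ω₀ = 2`, orders `(16, 17)`
  obtain ⟨𝒞f, Mc, Cα, c, C, Cℓ, hc, hall⟩ :=
    hfrd (by norm_num) (1 / 2) 2 (by norm_num) (by norm_num) 16 17 (by norm_num)
  -- replace `Cℓ` by `max Cℓ 0` (upper bounds survive)
  set Cℓ' : ℕ → ℝ := fun ℓ => max (Cℓ ℓ) 0 with hCℓ'
  have hC1 : 0 ≤ Cℓ' 1 := le_max_right _ _
  have hall' : ∀ L : ℕ, Odd L → 3 < L → ∀ N : ℕ, 1 ≤ N → ∀ (M : ℕ) [NeZero M], M = L ^ N →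
      ∀ A : Matrix (Fin 4) (Fin 4) ℝ, IsElliptic (1 / 2 : ℝ) 2 A →
        (∀ k, 1 ≤ k → k ≤ N + 1 →
          ∑ x : Fin 4 → ZMod M, 𝒞f L N M A k x = 0 ∧ ∀ x, 𝒞f L N M A k (-x) = 𝒞f L N M A k x) ∧
        (∀ k, 1 ≤ k → k ≤ N + 1 → ∀ φ : (Fin 4 → ZMod M) → ℝ, ∑ x, φ x = 0 →
          0 ≤ ∑ x, ∑ y, φ x * 𝒞f L N M A k (x - y) * φ y) ∧
        (∀ φ : (Fin 4 → ZMod M) → ℝ, ∑ x, φ x = 0 →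
          ellOp A (conv (fun x => ∑ k ∈ Finset.Icc 1 (N + 1), 𝒞f L N M A k x) φ) = φ) ∧
        (∀ k, 1 ≤ k → k ≤ N → Mc L N k ≤ 0 ∧
          ∀ x : Fin 4 → ZMod M, ((L : ℝ) ^ k) / 2 ≤ (supNorm x : ℝ) →
            𝒞f L N M A k x = Mc L N k) ∧
        (∀ k, 1 ≤ k → k ≤ N + 1 → ∀ B : Matrix (Fin 4) (Fin 4) ℝ, IsUnitSymm B →
          (∃ ε : ℝ, 0 < ε ∧ ∀ x : Fin 4 → ZMod M,
            ContDiffOn ℝ ⊤ (fun s : ℝ => 𝒞f L N M (A + s • B) k x) (Set.Ioo (-ε) ε)) ∧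
          ∀ α : Fin 4 → ℕ, ∑ i, α i ≤ 16 → ∀ ℓ : ℕ, ∀ x : Fin 4 → ZMod M,
            abs (iteratedDeriv ℓ (fun s : ℝ => iterDiff α (𝒞f L N M (A + s • B) k) x) 0)
              ≤ Cα α ℓ / (L : ℝ) ^ ((k - 1) * (4 - 2 + ∑ i, α i))) ∧
        (∀ k, 1 ≤ k → k ≤ N + 1 → ∀ j : ℕ, ∀ κ : Fin 4 → ZMod M, κ ≠ 0 → InShell L j κ →
          (j < k →
            c / (L : ℝ) ^ (2 * (4 + 17) + 1) * (L : ℝ) ^ (2 * j)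
                / (L : ℝ) ^ ((k - j) * (4 - 1 + 16)) ≤ (fourierCoeff (𝒞f L N M A k) κ).re ∧
            ‖fourierCoeff (𝒞f L N M A k) κ‖
              ≤ C * (L : ℝ) ^ (2 * (4 + 17) + 1) * (L : ℝ) ^ (2 * j)
                  / (L : ℝ) ^ ((k - j) * (4 - 1 + 16))) ∧
          (k ≤ j →
            c / (L : ℝ) ^ (2 * (4 + 17) + 1) * (L : ℝ) ^ (2 * k)
                ≤ (fourierCoeff (𝒞f L N M A k) κ).re ∧
            ‖fourierCoeff (𝒞f L N M A k) κ‖ ≤ C * (L : ℝ) ^ (2 * k)) ∧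
          ∀ B : Matrix (Fin 4) (Fin 4) ℝ, IsUnitSymm B → ∀ ℓ : ℕ, 1 ≤ ℓ →
            (j < k →
              ‖iteratedDeriv ℓ (fun s : ℝ => fourierCoeff (𝒞f L N M (A + s • B) k) κ) 0‖
                ≤ Cℓ' ℓ * (L : ℝ) ^ (2 * (4 + 17) + 1) * (L : ℝ) ^ (2 * j)
                    / (L : ℝ) ^ ((k - j) * (4 - 1 + 17))) ∧
            (k ≤ j →
              ‖iteratedDeriv ℓ (fun s : ℝ => fourierCoeff (𝒞f L N M (A + s • B) k) κ) 0‖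
                ≤ Cℓ' ℓ * (L : ℝ) ^ (2 * k))) := by
    intro L hLo hL3 N hN M _ hM A hA
    obtain ⟨h1, h2, h3, h4, h5, h6⟩ := hall L hLo hL3 N hN M hM A hA
    refine ⟨h1, h2, h3, h4, h5, fun k hk hkN j κ hκ hj => ?_⟩
    obtain ⟨ha, hb, hCℓ⟩ := h6 k hk hkN j κ hκ hj
    have hL0 : (0 : ℝ) ≤ (L : ℝ) := Nat.cast_nonneg L
    refine ⟨ha, hb, fun B hB ℓ hℓ => ⟨fun hjk => ((hCℓ B hB ℓ hℓ).1 hjk).trans ?_,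
      fun hkj => ((hCℓ B hB ℓ hℓ).2 hkj).trans ?_⟩⟩
    · have hx : 0 ≤ (L : ℝ) ^ (2 * (4 + 17) + 1) * (L : ℝ) ^ (2 * j) / (L : ℝ) ^ ((k - j) * (4 - 1 + 17)) := by
        positivity
      have := mul_le_mul_of_nonneg_right (le_max_left (Cℓ ℓ) 0) hx
      simpa [hCℓ', mul_assoc, mul_div_assoc] using this
    · exact mul_le_mul_of_nonneg_right (le_max_left (Cℓ ℓ) 0) (by positivity)
  -- fixed parameters
  have hd : 3 ≤ 4 := by norm_num
  have hθ0' : (0 : ℝ) < 1 / 8 := by norm_num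
  have hlam : (0 : ℝ) < 1 / 2 := by norm_num
  -- the weight schedule (Theorem 7.1), per `L`
  have hWpack := abkm_weight_bounds_of_package (d := 4) hd (Mord := 8) (R := 8) (by norm_num) le_rfl (n := 16) (ñ := 17)
    (by norm_num) (θbar := 1 / 8) (lam := 1 / 2) hθ0' (by norm_num) hlam (by norm_num) hc hall'
  -- the q-step integration constant `A_𝒫' = A_𝒫(θ)` at `θ = 1/16` (independent of `L`)
  set A𝒫' : ℝ := weightIntConstRho (1 / 8) (1 / 16) (traceConst 4 8 8 (1 / 2) (derivSum 4 16 fun θ' _ => Cα θ' 0)) with hA𝒫'def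
  have hA𝒫1 : 1 ≤ A𝒫' := one_le_weightIntConstRho hθ0' (by norm_num) (by norm_num)
    (traceConst_nonneg 4 8 8 hlam.le (derivSum_nonneg 4 16 _))
  have hA𝒫0 : 0 < A𝒫' := by linarith
  -- `L₀`: `L ≥ 256` and `L^4 · A_𝒫' · abkmContrConst 4 L 8 ≤ 1/8`
  have hlim : ∀ᶠ L : ℕ in atTop, (L : ℝ) ^ 4 * abkmContrConst 4 L 8 ≤ 1 / (8 * A𝒫') :=
    (tendsto_pow_mul_abkmContrConst hd 8).eventually (Iic_mem_nhds (by positivity))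
  obtain ⟨L₁, hL₁⟩ := Filter.eventually_atTop.1 hlim
  refine ⟨3, max 256 L₁, fun L hLodd hLge => ?_⟩
  have hL256 : 256 ≤ L := le_of_max_le_left hLge
  have hLL₁ : L₁ ≤ L := le_of_max_le_right hLge
  have hL : 2 ^ (4 + 3) + 16 * 8 ≤ L := by norm_num; omega
  have hL3 : 3 < L := by omega
  have hL0 : (0 : ℝ) < L := by exact_mod_cast hLodd.pos
  haveI : Fact (0 < L) := ⟨hLodd.pos⟩
  have hcontr : (L : ℝ) ^ 4 * (A𝒫' * abkmContrConst 4 L 8) ≤ 1 / 8 := by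
    have h := hL₁ L hLL₁
    calc (L : ℝ) ^ 4 * (A𝒫' * abkmContrConst 4 L 8) = A𝒫' * ((L : ℝ) ^ 4 * abkmContrConst 4 L 8) := by ring
      _ ≤ A𝒫' * (1 / (8 * A𝒫')) := mul_le_mul_of_nonneg_left h hA𝒫0.le
      _ = 1 / 8 := by field_simp
  -- the schedule at this `L`
  obtain ⟨μ, δ₁, δ₀, hμ, hδ₁, hδ₀, hBall⟩ := hWpack L hLodd hL
  -- `h`
  set hsq : ℝ := max (hZeroSq 4 8 δ₀ δ₁) 0 + secondDiffConst (fun θ' => Cα θ' 0) + 1 with hhsq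
  have hhsq0 : 0 < hsq := by
    have := secondDiffConst_nonneg (fun θ' => Cα θ' 0)
    have := le_max_right (hZeroSq 4 8 δ₀ δ₁) 0
    rw [hhsq]; linarith
  set h : ℝ := Real.sqrt hsq with hhdef
  have hh : 0 < h := Real.sqrt_pos.2 hhsq0
  haveI : Fact (0 < h) := ⟨hh⟩
  have hh2eq : h ^ 2 = hsq := Real.sq_sqrt hhsq0.le
  have hh0 : hZeroSq 4 8 δ₀ δ₁ ≤ h ^ 2 := by
    rw [hh2eq, hhsq]
    have := le_max_left (hZeroSq 4 8 δ₀ δ₁) 0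
    have := secondDiffConst_nonneg (fun θ' => Cα θ' 0)
    linarith
  have hh2 : secondDiffConst (fun θ' => Cα θ' 0) ≤ h ^ 2 := by
    rw [hh2eq, hhsq]
    have := le_max_right (hZeroSq 4 8 δ₀ δ₁) 0
    linarith
  -- `T₀`
  set src : ℝ := shellRatioConst c (Cℓ' 1) (L : ℝ) 4 17 with hsrc
  have hsrc0 : 0 ≤ src := shellRatioConst_nonneg hc hC1 hL0.le 4 17
  have hlog : 0 < Real.log (1 + 1 / 16) := Real.log_pos (by norm_num)
  set T₀ : ℝ := min (1 / 2) (Real.log (1 + 1 / 16) / (src + 1)) with hT₀def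
  have hT₀pos : 0 < T₀ := lt_min (by norm_num) (div_pos hlog (by linarith))
  have hT₀ : T₀ ≤ 1 / 2 := min_le_left _ _
  have hKT₀ : src * T₀ ≤ Real.log (1 + (1 / 16 : ℝ)) := by
    calc src * T₀ ≤ src * (Real.log (1 + 1 / 16) / (src + 1)) :=
          mul_le_mul_of_nonneg_left (min_le_right _ _) hsrc0
      _ = (src / (src + 1)) * Real.log (1 + 1 / 16) := by ring
      _ ≤ 1 * Real.log (1 + 1 / 16) := by
          refine mul_le_mul_of_nonneg_right ?_ hlog.le
          rw [div_le_one (by linarith)]; linarith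
      _ = Real.log (1 + 1 / 16) := one_mul _
  -- `A`
  set C87 : ℝ := pi2BoundConst 4 (((2 * 8 + 2 : ℕ) : ℝ) + ((4 / 2 + 1 : ℕ) : ℝ)) with hC87
  have hC870 : 0 ≤ C87 := pi2BoundConst_nonneg 4 (by positivity)
  obtain ⟨A₀, hA₀⟩ := exists_sigmaABKM_zero_lt 4 L 8 A𝒫' (δ := 1 / 8) (by norm_num)
  have hβev : ∀ᶠ A : ℝ in atTop, (L : ℝ) ^ 4 * (C87 * (A𝒫' * A⁻¹)) ≤ 1 / 6 := by
    have ht : Tendsto (fun A : ℝ => (L : ℝ) ^ 4 * (C87 * (A𝒫' * A⁻¹))) atTop (𝓝 0) := by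
      have := ((tendsto_inv_atTop_zero.const_mul A𝒫').const_mul C87).const_mul ((L : ℝ) ^ 4)
      simpa using this
    exact ht.eventually (Iic_mem_nhds (by norm_num))
  obtain ⟨A, ⟨hA1, hA𝒫A, hsmall, hCA⟩, hAA₀, hβ⟩ :=
    ((eventually_atTop_sideConditions 4 L 8 A𝒫').and ((eventually_ge_atTop A₀).and hβev)).exists
  have hA : 0 < A := by linarith
  have hσ0 : sigmaABKM 4 L 8 A A𝒫' 0 < 1 / 4 := by
    have := hA₀ A hAA₀; linarith
  -- `r`
  have hσev : ∀ᶠ r : ℝ in 𝓝 0, sigmaABKM 4 L 8 A A𝒫' r < 7 / 16 :=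
    (continuous_sigmaABKM 4 L 8 A A𝒫').continuousAt.eventually_lt continuousAt_const (by linarith)
  obtain ⟨δ, hδ, hδball⟩ := Metric.eventually_nhds_iff.1 ((eventually_nhds_ballConditions 4 8 A A𝒫').and hσev)
  set r : ℝ := min (δ / 2) (1 / 64) with hrdef
  have hr0 : 0 < r := lt_min (by linarith) (by norm_num)
  have hr : r ≤ 1 / 64 := min_le_right _ _
  have hrδ : dist r 0 < δ := by
    rw [Real.dist_eq, sub_zero, abs_of_pos hr0]
    exact (min_le_left _ _).trans_lt (by linarith)
  obtain ⟨⟨hv, hωA⟩, hσr⟩ := hδball hrδ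
  have hv0 : 0 ≤ vABKM 4 8 A A𝒫' r := vABKM_nonneg hA hA𝒫0.le hr0.le
  obtain ⟨hc3A, hc2A⟩ := hCA r hr0.le hr hv0 hv
  -- `ρ`, `ε`, `ρ𝒦`
  set 𝔥₀ : ℝ := fieldWt h (L : ℝ) 4 0 with h𝔥₀
  have h𝔥₀pos : 0 < 𝔥₀ := fieldWt_pos hh hL0 4 0
  set ρ : ℝ := min (1 / 16) (T₀ * 𝔥₀ ^ 2 / 32) with hρdef
  have hρpos : 0 < ρ := lt_min (by norm_num) (by positivity)
  have hρ16 : ρ ≤ 1 / 16 := min_le_left _ _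
  set ε : ℝ := min r ρ with hεdef
  have hεpos : 0 < ε := lt_min hr0 hρpos
  have hεr : ε ≤ r := min_le_left _ _
  have hερ : ε ≤ ρ := min_le_right _ _
  have hε1 : ε ≤ 1 := hεr.trans (hr.trans (by norm_num))
  set e₁ : ℝ := Real.exp (1 / 4) + 2 * Real.exp (3 / 8) with he₁
  have he₁pos : 0 < e₁ := by positivity
  set ρK : ℝ := ε / (2 * (e₁ * Real.exp 𝔥₀ * A)) with hρK
  have hρKpos : 0 < ρK := by positivity
  have hexp0 : Real.exp (fieldWt h (L : ℝ) 4 0 / (L : ℝ) ^ 0) = Real.exp 𝔥₀ := by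
    rw [pow_zero, div_one]
  have hprod : e₁ * (ρK * Real.exp 𝔥₀) * A = ε / 2 := by
    rw [hρK]; field_simp
  have h𝒦small : (Real.exp (1 / 4) + 2 * Real.exp (3 / 8)) *
      (ρK * Real.exp (fieldWt h (L : ℝ) 4 0 / (L : ℝ) ^ 0)) * A ≤ 1 / 2 := by
    rw [hexp0, ← he₁, hprod]; linarith
  have h𝒦ε : Real.exp (1 / 4) * (ρK * Real.exp (fieldWt h (L : ℝ) 4 0 / (L : ℝ) ^ 0)) * A ≤ ε := by
    rw [hexp0]
    have h1 : Real.exp (1 / 4) ≤ e₁ := by rw [he₁]; have := Real.exp_pos (3 / 8 : ℝ); linarith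
    calc Real.exp (1 / 4) * (ρK * Real.exp 𝔥₀) * A ≤ e₁ * (ρK * Real.exp 𝔥₀) * A := by
          gcongr
      _ = ε / 2 := hprod
      _ ≤ ε := by linarith
  -- the tuning-map bound
  have hqT₀ : 2 * (4 : ℝ) ^ 2 / (((L ^ (4 * 0) : ℕ) : ℝ) * (fieldWt h (L : ℝ) 4 0 / (L : ℝ) ^ 0) ^ 2) * ρ ≤ T₀ := by
    have e1 : ((L ^ (4 * 0) : ℕ) : ℝ) = 1 := by norm_num
    rw [e1, pow_zero, div_one, one_mul, ← h𝔥₀]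
    have hρle : ρ ≤ T₀ * 𝔥₀ ^ 2 / 32 := min_le_right _ _
    have h32 : 2 * (4 : ℝ) ^ 2 = 32 := by norm_num
    rw [h32]
    calc 32 / 𝔥₀ ^ 2 * ρ ≤ 32 / 𝔥₀ ^ 2 * (T₀ * 𝔥₀ ^ 2 / 32) :=
          mul_le_mul_of_nonneg_left hρle (by positivity)
      _ = T₀ := by field_simp
  -- contraction regime
  have hκ₁ : (3 / 4 : ℝ) * ((1 / 2 : ℝ) + (L : ℝ) ^ 4 * (pi2BoundConst 4 (((2 * 8 + 2 : ℕ) : ℝ) + ((4 / 2 + 1 : ℕ) : ℝ)) *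
      (A𝒫' * A⁻¹))) ≤ 7 / 8 := by
    rw [← hC87]; linarith
  have hκ₂ : sigmaABKM 4 L 8 A A𝒫' r ≤ (7 / 8 : ℝ) * (1 / 2) := by linarith
  -- now every `N`
  refine ⟨ρK, hρKpos, fun N hN n _ hn K hK => ?_⟩
  obtain ⟨h𝒦, h𝒦b, h𝒦ι⟩ := hK
  have hB := hBall N hN n hn
  have hallA := hall' L hLodd hL3 N hN n hn
  exact pertZ_ne_zero_of_package (M := n) (h := h) (L := L) (N := N) (Mord := 8) (R := 8) (n := 16) (ñ := 17)
    (θbar := 1 / 8) (lam := 1 / 2) (μ := μ) (δ₁ := δ₁) (δ₀ := δ₀)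
    (𝒞 := 𝒞f L N n) (Mc := Mc L N) (Cα := Cα) (c := c) (C := C) (Cℓ := Cℓ')
    (by norm_num) le_rfl hLodd hL (by norm_num) hn hθ0' hlam (by norm_num) (by norm_num) (by norm_num) hc hC1 hallA hB
    (pT := 4) (r₀ := 3) (by norm_num) (by norm_num) le_rfl hδ₀ hδ₁ hh0 hh2
    (θ := 1 / 16) (by norm_num) (by norm_num) (T₀ := T₀) hT₀ hKT₀ (A𝒫' := A𝒫') hA𝒫'def.symm
    (A := A) hA1 hA𝒫A hsmall (r := r) hr0.le hr hv hωA hc3A hc2A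
    (η := 1 / 2) (κ := 7 / 8) (ε := ε) (ρ := ρ) (by norm_num) (by norm_num) hκ₁ hκ₂ (by norm_num)
    hεpos.le hεr hερ hρ16 (𝒦 := K) (ρ𝒦 := ρK) h𝒦 h𝒦b h𝒦small h𝒦ε h𝒦ι (by norm_num) hqT₀

end Summit.HubbardSuperconductivity.HubbardSuperconductivity.Theorems.ComplexGFF

end
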